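import Literature.Probability.RandomPlanarGeometry.HexSAWHopf
import HarnessLib

/-!
# The discrete Hopf Umlaufsatz for self-avoiding paths of the honeycomb lattice

Topic `Literature/Probability/RandomPlanarGeometry`; second support file (after `HexSAWHopf.lean`)
for the discharge of `Literature.Probability.RandomPlanarGeometry.SAW.DuminilCopinSmirnov2012_lemma2`
and `…_thm1`. Source: H. Duminil-Copin, S. Smirnov, *The connective constant of the honeycomb
lattice equals `√(2+√2)`*, Ann. of Math. 175 (2012), 1653–1665 (arXiv:1007.0575), §2 ("we
define its winding `W_γ(a,b)` as the total rotation of the direction in radians when `γ` is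
traversed from `a` to `b`") and the evaluation of the boundary windings in the proof of Lemma 2
(p. 5).

## Contents (namespace `Literature.Probability.RandomPlanarGeometry.SAW.HV`, coordinate model)

* `toReal_argDiff_edir`: the turn `turn u v w = ±1` of `HexSAWWinding` is the exterior angle of
  the embedded two-step path, in units of `π/3`; `pturn_eq_sum`.
* **`hopf_path`**: for a self-avoiding lattice path `P = [v₀, …, v_{m+1}]`,
  `(π/3) · pturn P = (angle swept by the secant into v_{m+1}) + (angle swept by the secant from
  v₀)` — `Hopf.hopf_open` applied with the subtended-angle bound `subtended_pos`.
* **`hopf_path_eval`**: if all vertices lie in a closed half-plane seen from the start and in a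
  closed half-plane seen from the end, the swept angles are differences of arguments, whence a
  closed formula for the total winding in terms of the first and last edge and the chord.
* `arg_omg`, `arg_omg_sq`, `arg_neg_omg`, `arg_emb_neg_one_two`, `arg_omg_sq_mul`,
  `arg_neg_omg_mul`: arguments of the lattice directions `ω = e^{iπ/3}`, `j = ω²`, `j̄ = -ω`,
  `e₀ = -1 + 2ω = i√3` and of their products with vectors of suitable sectors.
* **`pturn_walk_eq`**: Hopf's formula for a self-avoiding walk `w, O, …, v, u` from the mid-edge
  `a` of a domain of the upper half-plane to a boundary half-edge `(v, u)` behind which the whole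
  walk lies: `(π/3)·pturn = arg(u - w) - arg(c (u - w))`, `c` the rotation taking the exit
  direction to `i`. The four boundary classes of the strip are treated in
  `HexSAWBoundaryWinding.lean`.
-/

noncomputable section

open Finset

namespace Literature.Probability.RandomPlanarGeometry.SAW

namespace HV

open Real Hopf

/-! ### Turns are exterior angles of `±π/3` -/

/-- `arg (exp (iθ)) = θ` as an angle. [folklore] -/
theorem arg_exp_mul_I_coe (θ : ℝ) :
    (Complex.arg (Complex.exp (θ * Complex.I)) : Angle) = (θ : Angle) := by
  rw [Complex.arg_exp_mul_I, Angle.coe_toIocMod]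

/-- `ω ≠ 0`. [folklore] -/
theorem omg_ne_zero : omg ≠ 0 := Complex.exp_ne_zero _

/-- `arg ω = π/3` as an angle. [folklore] -/
theorem arg_omg_coe : (Complex.arg omg : Angle) = ((π / 3 : ℝ) : Angle) := by
  rw [omg]; exact arg_exp_mul_I_coe _

/-- `arg ω² = 2π/3` as an angle. [folklore] -/
theorem arg_omg_sq_coe : (Complex.arg (omg ^ 2) : Angle) = ((2 * π / 3 : ℝ) : Angle) := by
  have : omg ^ 2 = Complex.exp ((2 * π / 3 : ℝ) * Complex.I) := by
    rw [omg, ← Complex.exp_nat_mul]; congr 1; push_cast; ring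
  rw [this]; exact arg_exp_mul_I_coe _

/-- The vector between distinct vertices is nonzero. [folklore] -/
theorem edir_ne_zero_of_ne {u v : HV} (h : u ≠ v) : edir u v ≠ 0 := by
  rw [edir, Ne, emb_eq_zero_iff, sub_eq_zero]
  exact fun e => h (pos_injective e).symm

/-- The direction of an edge is nonzero. [folklore] -/
theorem edir_ne_zero {u v : HV} (h : hvGraph.Adj u v) : edir u v ≠ 0 := edir_ne_zero_of_ne h.ne

/-- **The turn is the exterior angle**: along a two-step path `u → v → w` of `ℍ` the direction
rotates by `(π/3) · turn u v w` (`+π/3` for a left turn, `-π/3` for a right turn), so that DCS's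
winding "total rotation of the direction in radians" of a walk is `(π/3) · pturn`.
[cite: DuminilCopinSmirnov2012, §2] -/
theorem toReal_argDiff_edir {u v w : HV} (huv : hvGraph.Adj u v) (hvw : hvGraph.Adj v w)
    (huw : u ≠ w) :
    ((Complex.arg (edir v w) : Angle) - (Complex.arg (edir u v) : Angle)).toReal =
      (π / 3) * turn u v w := by
  have hvu := huv.symm
  have h0 := edir_ne_zero hvu
  rcases adj_cases hvu hvw with rfl | rfl | rfl
  · exact absurd rfl huw
  · -- right turn
    rw [turn_ccw hvu, edir_ccw hvu, edir_rev v u,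
      Complex.arg_mul_coe_angle h0 (pow_ne_zero _ omg_ne_zero), Complex.arg_neg_coe_angle h0,
      arg_omg_sq_coe, show ((Complex.arg (edir v u) : Angle) + ((2 * π / 3 : ℝ) : Angle) -
        ((Complex.arg (edir v u) : Angle) + (π : Angle))) = ((2 * π / 3 - π : ℝ) : Angle) by
        rw [Angle.coe_sub]; abel]
    rw [show (2 * π / 3 - π : ℝ) = -(π / 3) by ring, Angle.toReal_coe_eq_self_iff.2]
    · push_cast; ring
    · constructor <;> linarith [Real.pi_pos]
  · -- left turn
    rw [turn_cw hvu, edir_cw hvu, edir_rev v u, argDiff_neg_neg (mul_ne_zero h0 omg_ne_zero) h0,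
      Complex.arg_mul_coe_angle h0 omg_ne_zero, arg_omg_coe, add_sub_cancel_left,
      Angle.toReal_coe_eq_self_iff.2]
    · push_cast; ring
    · constructor <;> linarith [Real.pi_pos]

/-! ### Turning numbers of paths as sums; the Hopf identity for lattice paths -/

/-- In range, `getD` is the list entry. [folklore] -/
theorem getD_eq_getElem_of_lt {P : List HV} {i : ℕ} (h : i < P.length) :
    P.getD i hvOrigin = P[i] := by
  rw [List.getD_eq_getElem?_getD, List.getElem?_eq_getElem h, Option.getD_some]

/-- The turning number of a path is the sum of its turns. [cite: DuminilCopinSmirnov2012, §2] -/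
theorem pturn_eq_sum : ∀ P : List HV,
    (pturn P : ℝ) = ∑ j ∈ range (P.length - 2),
      (turn (P.getD j hvOrigin) (P.getD (j + 1) hvOrigin) (P.getD (j + 2) hvOrigin) : ℝ)
  | [] => by simp [pturn]
  | [_] => by simp [pturn]
  | [_, _] => by simp [pturn]
  | a :: b :: c :: L => by
    rw [pturn, show (a :: b :: c :: L).length - 2 = (L.length) + 1 by simp, sum_range_succ',
      Int.cast_add, pturn_eq_sum (b :: c :: L), show (b :: c :: L).length - 2 = L.length by simp,
      add_comm]
    congr 1

/-- Differences of embedded vertices are edge vectors. [folklore] -/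
theorem emb_pos_getD_sub (P : List HV) (i j : ℕ) :
    emb (pos (P.getD j hvOrigin)) - emb (pos (P.getD i hvOrigin)) =
      edir (P.getD i hvOrigin) (P.getD j hvOrigin) := by
  rw [edir, emb_sub]

/-- **Discrete Hopf identity for simple paths of the honeycomb lattice**: the total turning
`(π/3) · pturn P` of a self-avoiding path `P = [v₀, …, v_{m+1}]` equals the angle swept by the
secant into the end `v_{m+1}` plus the angle swept by the secant from the start `v₀`.
[folklore] -/
theorem hopf_path {P : List HV} (hc : P.IsChain hvGraph.Adj) (hnd : P.Nodup) {m : ℕ}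
    (hlen : P.length = m + 2) :
    (π / 3) * pturn P =
      ∑ i ∈ range m, ((Complex.arg (edir (P.getD (i + 1) hvOrigin) (P.getD (m + 1) hvOrigin)) :
          Angle) - (Complex.arg (edir (P.getD i hvOrigin) (P.getD (m + 1) hvOrigin)) : Angle)).toReal +
        ∑ i ∈ range m, ((Complex.arg (edir (P.getD 0 hvOrigin) (P.getD (i + 2) hvOrigin)) : Angle) -
          (Complex.arg (edir (P.getD 0 hvOrigin) (P.getD (i + 1) hvOrigin)) : Angle)).toReal := by
  have hadj : ∀ i, i ≤ m → hvGraph.Adj (P.getD i hvOrigin) (P.getD (i + 1) hvOrigin) := by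
    intro i hi
    rw [getD_eq_getElem_of_lt (by omega), getD_eq_getElem_of_lt (by omega)]
    exact hc.getElem i (by omega)
  have hne : ∀ i j, i ≤ m + 1 → j ≤ m + 1 → i ≠ j → P.getD i hvOrigin ≠ P.getD j hvOrigin := by
    intro i j hi hj hij e
    rw [getD_eq_getElem_of_lt (by omega), getD_eq_getElem_of_lt (by omega)] at e
    exact hij ((List.Nodup.getElem_inj_iff hnd).1 e)
  have key := hopf_open (fun i => emb (pos (P.getD i hvOrigin))) m ?_
  · simp only [emb_pos_getD_sub] at key
    rw [← key, pturn_eq_sum, hlen, Nat.add_sub_cancel, mul_sum]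
    refine sum_congr rfl fun j hj => ?_
    rw [mem_range] at hj
    exact (toReal_argDiff_edir (hadj j (by omega)) (hadj (j + 1) (by omega))
      (hne j (j + 2) (by omega) (by omega) (by omega))).symm
  · intro k j hk hj h1 h2
    rw [← emb_sub, ← emb_sub]
    exact subtended_pos (hadj k hk) (hne j k hj (by omega) h1) (hne j (k + 1) hj (by omega) h2)

/-- **Hopf's evaluation of the swept angles.** If moreover all vertices lie in the closed
half-plane `{Im(c₁ (z - v₀)) ≥ 0}` seen from the start and in `{Im(c₂ (v_{m+1} - z)) ≥ 0}` seen
from the end, the two swept angles are plain differences of arguments, and the total turning is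
`arg(c₂ t₁) - arg(c₂ D) + arg(c₁ D) - arg(c₁ t₀)` with `t₀`, `t₁` the first and last edge
vectors and `D = v_{m+1} - v₀` the chord. [folklore] -/
theorem hopf_path_eval {P : List HV} (hc : P.IsChain hvGraph.Adj) (hnd : P.Nodup) {m : ℕ}
    (hlen : P.length = m + 2) {c₁ c₂ : ℂ} (hc₁ : c₁ ≠ 0) (hc₂ : c₂ ≠ 0)
    (h₁ : ∀ i ≤ m + 1, 0 ≤ (c₁ * edir (P.getD 0 hvOrigin) (P.getD i hvOrigin)).im)
    (h₂ : ∀ i ≤ m + 1, 0 ≤ (c₂ * edir (P.getD i hvOrigin) (P.getD (m + 1) hvOrigin)).im) :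
    (π / 3) * pturn P =
      Complex.arg (c₂ * edir (P.getD m hvOrigin) (P.getD (m + 1) hvOrigin)) -
          Complex.arg (c₂ * edir (P.getD 0 hvOrigin) (P.getD (m + 1) hvOrigin)) +
        (Complex.arg (c₁ * edir (P.getD 0 hvOrigin) (P.getD (m + 1) hvOrigin)) -
          Complex.arg (c₁ * edir (P.getD 0 hvOrigin) (P.getD 1 hvOrigin))) := by
  have hadj : ∀ i, i ≤ m → hvGraph.Adj (P.getD i hvOrigin) (P.getD (i + 1) hvOrigin) := by
    intro i hi
    rw [getD_eq_getElem_of_lt (by omega), getD_eq_getElem_of_lt (by omega)]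
    exact hc.getElem i (by omega)
  have hne : ∀ i j, i ≤ m + 1 → j ≤ m + 1 → i ≠ j → P.getD i hvOrigin ≠ P.getD j hvOrigin := by
    intro i j hi hj hij e
    rw [getD_eq_getElem_of_lt (by omega), getD_eq_getElem_of_lt (by omega)] at e
    exact hij ((List.Nodup.getElem_inj_iff hnd).1 e)
  rw [hopf_path hc hnd hlen]
  congr 1
  · -- swept angle into the end: vectors `q_{m+1} - q_i`
    have := sum_toReal_argDiff_eq hc₂ (fun i => edir (P.getD i hvOrigin) (P.getD (m + 1) hvOrigin)) m
      (fun i hi => edir_ne_zero_of_ne (hne i (m + 1) (by omega) le_rfl (by omega)))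
      (fun i hi => h₂ i (by omega)) ?_
    · simpa using this
    · intro i hi
      refine lt_of_lt_of_le (abs_toReal_argDiff_lt ?_) (by linarith [Real.pi_pos])
      simp only [edir]
      exact subtended_pos' (hadj i (by omega)) (hne (m + 1) i le_rfl (by omega) (by omega))
        (hne (m + 1) (i + 1) le_rfl (by omega) (by omega))
  · -- swept angle from the start: vectors `q_{i+1} - q_0`
    have := sum_toReal_argDiff_eq hc₁ (fun i => edir (P.getD 0 hvOrigin) (P.getD (i + 1) hvOrigin)) m
      (fun i hi => edir_ne_zero_of_ne (hne 0 (i + 1) (by omega) (by omega) (by omega)))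
      (fun i hi => h₁ (i + 1) (by omega)) ?_
    · simpa using this
    · intro i hi
      refine lt_of_lt_of_le (abs_toReal_argDiff_lt ?_) (by linarith [Real.pi_pos])
      simp only [edir]
      exact subtended_pos (hadj (i + 1) (by omega)) (hne 0 (i + 1) (by omega) (by omega) (by omega))
        (hne 0 (i + 2) (by omega) (by omega) (by omega))

/-! ### Arguments of the lattice directions -/

/-- `arg ω = π/3`. [folklore] -/
theorem arg_omg : Complex.arg omg = π / 3 := by
  rw [omg, Complex.arg_exp_mul_I, toIocMod_eq_self]
  constructor <;> linarith [Real.pi_pos]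

/-- `arg ω² = 2π/3`. [folklore] -/
theorem arg_omg_sq : Complex.arg (omg ^ 2) = 2 * π / 3 := by
  have : omg ^ 2 = Complex.exp ((2 * π / 3 : ℝ) * Complex.I) := by
    rw [omg, ← Complex.exp_nat_mul]; congr 1; push_cast; ring
  rw [this, Complex.arg_exp_mul_I, toIocMod_eq_self]
  constructor <;> linarith [Real.pi_pos]

/-- `arg (-ω) = -2π/3`. [folklore] -/
theorem arg_neg_omg : Complex.arg (-omg) = -(2 * π / 3) := by
  have : -omg = Complex.exp ((4 * π / 3 : ℝ) * Complex.I) := by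
    have h3 := omg_pow_three
    have e : Complex.exp ((4 * π / 3 : ℝ) * Complex.I) = omg ^ 4 := by
      rw [omg, ← Complex.exp_nat_mul]; congr 1; push_cast; ring
    rw [e, pow_succ, h3]; ring
  rw [this, Complex.arg_exp_mul_I, toIocMod_eq_iff]
  refine ⟨⟨by linarith [Real.pi_pos], by linarith [Real.pi_pos]⟩, 1, by simp; ring⟩

/-- `arg ω̄ = -π/3`. [folklore] -/
theorem arg_conj_omg : Complex.arg ((starRingEnd ℂ) omg) = -(π / 3) := by
  rw [Complex.arg_conj, arg_omg, if_neg]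
  linarith [Real.pi_pos]

/-- `-1 + 2ω = i√3`: the upward vertical edge vector `e₀`. [folklore] -/
theorem emb_neg_one_two : emb (-1, 2) = (Real.sqrt 3 : ℂ) * Complex.I := by
  apply Complex.ext
  · rw [emb_re]; simp
  · rw [emb_im]; simp; ring

/-- The upward vertical direction has argument `π/2`. [folklore] -/
theorem arg_emb_neg_one_two : Complex.arg (emb (-1, 2)) = π / 2 := by
  rw [emb_neg_one_two, Complex.arg_real_mul _ (by positivity), Complex.arg_I]

/-- A lattice vector with `a > 0`, `b ≥ 0` points into the sector `0 ≤ arg < π/3`, so that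
multiplying by `ω² = j` adds `2π/3` to its argument. [folklore] -/
theorem arg_omg_sq_mul {D : ℤ × ℤ} (ha : 0 < D.1) (hb : 0 ≤ D.2) :
    Complex.arg (omg ^ 2 * emb D) = Complex.arg (emb D) + 2 * π / 3 := by
  have hD : emb D ≠ 0 := by
    rw [Ne, emb_eq_zero_iff]; rintro rfl; simp at ha
  have h0 : 0 ≤ Complex.arg (emb D) := by
    rw [Complex.arg_nonneg_iff, emb_im]; positivity
  -- `arg (D ω̄) = arg D - π/3 < 0`
  have hc : (starRingEnd ℂ) omg ≠ 0 := by
    rw [map_ne_zero]; exact omg_ne_zero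
  have h1 : Complex.arg (emb D * (starRingEnd ℂ) omg) = Complex.arg (emb D) - π / 3 := by
    rw [(Complex.arg_mul_eq_add_arg_iff hD hc).2, arg_conj_omg]; · ring
    rw [arg_conj_omg]
    constructor <;> linarith [Complex.arg_le_pi (emb D), Real.pi_pos]
  have h2 : Complex.arg (emb D * (starRingEnd ℂ) omg) < 0 := by
    rw [Complex.arg_neg_iff, Complex.mul_im, Complex.conj_re, Complex.conj_im, omg_re, omg_im,
      emb_re, emb_im]
    have : (0 : ℝ) < D.1 := by exact_mod_cast ha
    have hs : (0 : ℝ) < Real.sqrt 3 := by positivity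
    nlinarith
  rw [(Complex.arg_mul_eq_add_arg_iff (pow_ne_zero _ omg_ne_zero) hD).2, arg_omg_sq]; · ring
  rw [arg_omg_sq]
  constructor <;> linarith [Real.pi_pos]

/-- Multiplying a nonzero vector of the closed upper half-plane by `-ω = j̄` subtracts `2π/3`
from its argument. [folklore] -/
theorem arg_neg_omg_mul {D : ℂ} (hD : D ≠ 0) (hb : 0 ≤ D.im) :
    Complex.arg (-omg * D) = Complex.arg D - 2 * π / 3 := by
  have h0 : 0 ≤ Complex.arg D := Complex.arg_nonneg_iff.2 hb
  rw [(Complex.arg_mul_eq_add_arg_iff (neg_ne_zero.2 omg_ne_zero) hD).2, arg_neg_omg]; · ring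
  rw [arg_neg_omg]
  constructor <;> linarith [Complex.arg_le_pi D, Real.pi_pos]

/-! ### Windings of walks from `a` to the boundary -/

section Boundary

variable {V : Finset HV} {l : List HV} {u : HV}

/-- The last vertex of a walk list. [folklore] -/
theorem getD_walk_last (l : List HV) (u : HV) :
    (wOut :: (l ++ [u])).getD (l.length + 1) hvOrigin = u := by
  rw [List.getD_cons_succ, getD_eq_getElem_of_lt (by simp), List.getElem_concat_length rfl]

/-- The last inner vertex of a walk list. [folklore] -/
theorem getD_walk_prev (hl : l ≠ []) (u : HV) :
    (wOut :: (l ++ [u])).getD l.length hvOrigin = l.getLast hl := by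
  obtain ⟨n, hn⟩ : ∃ n, l.length = n + 1 :=
    Nat.exists_eq_add_one_of_ne_zero (fun h => hl (List.eq_nil_of_length_eq_zero h))
  rw [hn, List.getD_cons_succ, getD_eq_getElem_of_lt (by simp; omega),
    List.getElem_append_left (by omega), List.getLast_eq_getElem]
  congr 1; omega

/-- The first inner vertex of a walk list is `O`. [folklore] -/
theorem getD_walk_one (hh : l.head? = some hvOrigin) (u : HV) :
    (wOut :: (l ++ [u])).getD 1 hvOrigin = hvOrigin := by
  cases l with
  | nil => simp at hh
  | cons a l => simp only [List.head?_cons, Option.some.injEq] at hh; subst hh; rfl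

/-- Entries of the walk list. [folklore] -/
theorem getD_walk_mem {i : ℕ} (hi : i ≤ l.length + 1) (u : HV) :
    (wOut :: (l ++ [u])).getD i hvOrigin = wOut ∨ (wOut :: (l ++ [u])).getD i hvOrigin ∈ l ∨
      (wOut :: (l ++ [u])).getD i hvOrigin = u := by
  have : (wOut :: (l ++ [u])).getD i hvOrigin ∈ wOut :: (l ++ [u]) := by
    rw [getD_eq_getElem_of_lt (by simp; omega)]; exact List.getElem_mem _
  simpa [or_assoc] using this

/-- The second coordinate of `pos` is at least `1` on the upper half-plane. [folklore] -/
theorem one_le_pos_snd {x : HV} (hx : 0 ≤ x.2.1) : 1 ≤ (pos x).2 := by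
  obtain ⟨a, b, c⟩ := x; cases c <;> simp [pos] at hx ⊢ <;> omega

/-- `pos w = (2, -1)`. [folklore] -/
@[simp] theorem pos_wOut : pos wOut = (2, -1) := rfl

/-- `pos O = (1, 1)`. [folklore] -/
@[simp] theorem pos_hvOrigin : pos hvOrigin = (1, 1) := rfl

/-- **Hopf's formula for a walk from `a` to the boundary.** For a self-avoiding walk
`w, O, …, v, u` in a domain `V` of the upper half-plane, leaving `V` through the final half-edge
`(v, u)`, such that all its vertices lie in the closed half-plane `{Im(c(u - ·)) ≥ 0}` behind the
exit and the exit half-edge points in the direction `arg = π/2` after rotation by `c`: the total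
winding `(π/3)·pturn` is `arg(u - w) - arg(c(u - w))` (the walk starts vertically upwards from
the lowest point `w`, so that the swept angle from the start is `arg(u - w) - π/2`).
[cite: DuminilCopinSmirnov2012, proof of Lemma 2] -/
theorem pturn_walk_eq (hV : ∀ w ∈ V, 0 ≤ w.2.1) (hl : l ≠ [])
    (hP : IsMidWalk V (wOut :: (l ++ [u]))) (huV : u ∉ V) (huw : u ≠ wOut)
    (hub : -1 ≤ (pos u).2) {c : ℂ} (hc : c ≠ 0)
    (h₂ : ∀ x ∈ wOut :: (l ++ [u]), 0 ≤ (c * emb (pos u - pos x)).im)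
    (ht : Complex.arg (c * emb (pos u - pos (l.getLast hl))) = π / 2) :
    (π / 3) * pturn (wOut :: (l ++ [u])) =
      Complex.arg (emb (pos u - pos wOut)) - Complex.arg (c * emb (pos u - pos wOut)) := by
  obtain ⟨-, hh, -, hlV, hnd, -⟩ := (isMidWalk_cons_append_iff V hl u).1 hP
  have hlen : (wOut :: (l ++ [u])).length = l.length + 2 := by simp
  have hwl : wOut ∉ l := fun h => by have := hV _ (hlV _ h); simp [wOut] at this
  have hul : u ∉ l := fun h => huV (hlV _ h)
  have hPnd : (wOut :: (l ++ [u])).Nodup := by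
    rw [List.nodup_cons, List.mem_append, List.mem_singleton, not_or]
    exact ⟨⟨hwl, Ne.symm huw⟩, hnd.append (List.nodup_singleton u) (List.disjoint_singleton.2 hul)⟩
  have hsnd : ∀ i ≤ l.length + 1, -1 ≤ (pos ((wOut :: (l ++ [u])).getD i hvOrigin)).2 := by
    intro i hi
    rcases getD_walk_mem hi u with h | h | h
    · rw [h]; simp
    · have := one_le_pos_snd (hV _ (hlV _ h)); omega
    · rw [h]; exact hub
  have key := hopf_path_eval hP.1 hPnd hlen one_ne_zero hc ?_ ?_
  · rw [key, getD_walk_last, getD_walk_prev hl, List.getD_cons_zero, getD_walk_one hh, one_mul,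
      one_mul, edir, edir, edir, ht, pos_hvOrigin, pos_wOut,
      show ((1, 1) - (2, -1) : ℤ × ℤ) = (-1, 2) by simp, arg_emb_neg_one_two]
    ring
  · intro i hi
    rw [one_mul, edir, emb_im, List.getD_cons_zero, Prod.snd_sub, pos_wOut]
    have := hsnd i hi
    have : (0 : ℝ) ≤ ((pos ((wOut :: (l ++ [u])).getD i hvOrigin)).2 - (-1) : ℤ) := by
      exact_mod_cast (by omega)
    positivity
  · intro i hi
    rw [edir, getD_walk_last]
    apply h₂
    rw [getD_eq_getElem_of_lt (by simp; omega)]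
    exact List.getElem_mem _

end Boundary

end HV

end Literature.Probability.RandomPlanarGeometry.SAW
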